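import Summits.CriticalPhenomena.PercolationContinuityZ3.Theorems.Transplant.SkelFrmQuasiBParamsSlotsRS
import Summits.CriticalPhenomena.PercolationContinuityZ3.Theorems.Transplant.SkelFrmBParamsSlotsRS
import Summits.CriticalPhenomena.PercolationContinuityZ3.Theorems.Transplant.SkelFrmFromBParamsRootA
import Summits.CriticalPhenomena.PercolationContinuityZ3.Theorems.Transplant.SkelFrmBParamsRootA
import Summits.CriticalPhenomena.PercolationContinuityZ3.Theorems.Transplant.SkelFrmQuasiBChoiceNums
import Summits.CriticalPhenomena.PercolationContinuityZ3.Theorems.Transplant.SkelFrmBChoiceNums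
import Summits.CriticalPhenomena.PercolationContinuityZ3.Theorems.Transplant.PlanarSkeletonFrmQuasiDefs
import Summits.CriticalPhenomena.PercolationContinuityZ3.Theorems.Transplant.PlanarSkeletonFrmDefs
import Summits.CriticalPhenomena.PercolationContinuityZ3.Theorems.Transplant.SkelPhiStepIDataNS
import Summits.CriticalPhenomena.PercolationContinuityZ3.Theorems.Transplant.SkelFrmQuasi1ParamsPO
import Summits.CriticalPhenomena.PercolationContinuityZ3.Theorems.Transplant.SkelFrmQuasiBParamsLF
import Summits.CriticalPhenomena.PercolationContinuityZ3.Theorems.Transplant.SkelFrmQuasi1SlotTypes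
import HarnessLib
import Summits.CriticalPhenomena.PercolationContinuityZ3.Theorems.Transplant.SkelFrmBParamsBridgeF
/-!
# GEN-Q PORT (WAVE-Q table v0.8 section 2, row G101, U-level L13; captain R-6/R-7 2026-08-27: carrier token swap `PlanarSkeletonFrmFrom ↦ PlanarSkeletonFrmQuasi`)
# of the tree module «Transplant/SkelFrmFromBParamsBridgeF» (sha256 fb89423eee6bac5b…) onto the quasi-step carrier `PlanarSkeletonFrmQuasi` (p507026): «SkelFrmQuasiBParamsBridgeF»

ORIGINAL TITLE: N2 (frames-only node `SamePDropOfSkeletonFrmFrom₁`, OPEN), (F) value layer — part BridgeF: **THE WIDE BRIDGE PAIR FOR THE y′-FACE AT THE (S0) KIT LEVELS**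

builds on p205010 (kernel theorem, internal audit signed; external expert review pending) — nothing in this file uses p205010; NOTHING is claimed about any open node
((N3-b), the end state).  Lane `prim-bschramm`, seat `prim-hp-8` (gen 62; GEN-Q pen, family BChoiceRoot*/1Root*/BParamsKit·Bridge; tool = captain gen-1 g4's port_genq.py R-14 + p3-g30 T1/T2 + stmt-g33 --force-keep).  Helper file (`--supports stmt-CriticalPhenomena-4575 --as helper`).
PORT RULES (U-wave r1–r4 re-used, GEN-Q hunk classes of p3-g29 #6136): declaration order, names and proof texts are those of «SkelFrmFromBParamsBridgeF», byte-identical except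
(i) the carrier token `PlanarSkeletonFrmFrom ↦ PlanarSkeletonFrmQuasi` in binders, `namespace`/`end` lines and qualified names (module names `SkelFrmFrom… ↦ SkelFrmQuasi…`
in imports of already-ported rows); (ii) `Φ.step ↦ Φ.qstep` with the called Steps lemma replaced by its `…Q`/`_q` twin and the cost `Φ.M` threaded (none in this file unless
listed below); (iii) `Φ.cyl_connected ↦ Φ.cyl_reach` readers (none unless listed); (iv) graph-ball radii / window floors ×`Φ.M` (none unless listed).  HAND HUNK (L-KitS-1 / L-FLOORMAP-1 ⑧): the bridge index reads the kit's
R′ at the window cost of record — `KS0.R'0 κ Φ t p D mk ↦ KS0.R'0N κ Φ (KS.NQ Φ) t p D mk` (stmt-g33's G017 «SkelFrmQuasiBChoiceNums», hp-8's «SkelFrmQuasiBParamsKitSN»).  Carrier-free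
residents stay imported/exported from the original «SkelFrmBParamsBridgeF» exactly as in the FrmFrom port.  Docstrings and citations are the original's.

-/

noncomputable section

open scoped Classical

namespace Summit.CriticalPhenomena.PercolationContinuityZ3.Theorems.Transplant

namespace PlanarSkeletonFrmQuasi

namespace NegB

-- GEN-Q residents of the row-less «SkelFrmFromBParamsB» read below and not re-exported by the imported parents (design owner p3-g30, L-cone-2 / T3):
export PlanarSkeletonFrmFrom.NegB (vB MB_facts nB_facts ℓB_ge)

open Literature.Probability.Percolation Literature.Probability.LatticeModels SimpleGraph
open SkelConc (Consts)
open Skelφ.StepI (DataN)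
open Neg

namespace KS

section BridgeF

/-- **The y′-face bridge clearance** `bF c := M_u + (c+2)·RA′ + 1`. [this work] -/
def bF (κ : Consts) {V : Type} [DecidableEq V] [Countable V] {G : SimpleGraph V} [G.LocallyFinite] (Φ : PlanarSkeletonFrmQuasi G) (t : V) (p : unitInterval) (D : Skelφ.StepI.DataNS V) (c : ℕ) (mk : ℕ) : ℕ := Mu D + (c + 2) * KS0.R'0N κ Φ (KS.NQ Φ) t p D mk + 1

/-- **The y′-face bridge zone-index floor** `mbF c := max (2·bF + 26) (24·M_u + 63)`. [this work] -/
def mbF (κ : Consts) {V : Type} [DecidableEq V] [Countable V] {G : SimpleGraph V} [G.LocallyFinite] (Φ : PlanarSkeletonFrmQuasi G) (t : V) (p : unitInterval) (D : Skelφ.StepI.DataNS V) (c : ℕ) (mk : ℕ) : ℕ := max (2 * bF κ Φ t p D c mk + 26) (24 * Mu D + 63)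

/-- The y′-face bridge zone index `MBF := MB D mbF`. [this work] -/
abbrev MBF (κ : Consts) {V : Type} [DecidableEq V] [Countable V] {G : SimpleGraph V} [G.LocallyFinite] (Φ : PlanarSkeletonFrmQuasi G) (t : V) (p : unitInterval) (D : Skelφ.StepI.DataNS V) (c : ℕ) (mk : ℕ) : ℕ := MB D (mbF κ Φ t p D c mk)

/-- The y′-face bridge width `nBF := nB D mbF bF`. [this work] -/
abbrev nBF (κ : Consts) {V : Type} [DecidableEq V] [Countable V] {G : SimpleGraph V} [G.LocallyFinite] (Φ : PlanarSkeletonFrmQuasi G) (t : V) (p : unitInterval) (D : Skelφ.StepI.DataNS V) (c : ℕ) (mk : ℕ) : ℕ := nB D (mbF κ Φ t p D c mk) (bF κ Φ t p D c mk)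

/-- The y′-face bridge shear. [this work] -/
abbrev hBF (κ : Consts) {V : Type} [DecidableEq V] [Countable V] {G : SimpleGraph V} [G.LocallyFinite] (Φ : PlanarSkeletonFrmQuasi G) (t : V) (p : unitInterval) (D : Skelφ.StepI.DataNS V) (c : ℕ) (mk : ℕ) : ℤ := hB t D (mbF κ Φ t p D c mk) (bF κ Φ t p D c mk)

/-- The y′-face bridge half-length. [this work] -/
abbrev ℓBF (κ : Consts) {V : Type} [DecidableEq V] [Countable V] {G : SimpleGraph V} [G.LocallyFinite] (Φ : PlanarSkeletonFrmQuasi G) (t : V) (p : unitInterval) (D : Skelφ.StepI.DataNS V) (c : ℕ) (mk : ℕ) : ℕ := ℓB t D (mbF κ Φ t p D c mk) (bF κ Φ t p D c mk)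

-- GEN-Q (R-2, captain 2026-08-27): `PlanarSkeletonFrmFrom.NegB.KS.vBF` is not in the used cone of the node top — not ported.

/-- `bF = M_u + (c+2)RA′ + 1`, `M_u ≤ bF`, `(c+2)·RA′ + 1 ≤ bF`, `bR ≤ bF` once `D.k ≤ M_u + c·RA′`. [folklore] -/
theorem bF_facts (κ : Consts) {V : Type} [DecidableEq V] [Countable V] {G : SimpleGraph V} [G.LocallyFinite] (Φ : PlanarSkeletonFrmQuasi G) (t : V) (p : unitInterval) (D : Skelφ.StepI.DataNS V) (c : ℕ) (mk : ℕ) : bF κ Φ t p D c mk = Mu D + (c + 2) * KS0.R'0N κ Φ (KS.NQ Φ) t p D mk + 1 ∧ Mu D ≤ bF κ Φ t p D c mk ∧ (c + 2) * KS0.R'0N κ Φ (KS.NQ Φ) t p D mk + 1 ≤ bF κ Φ t p D c mk :=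
  ⟨rfl, by unfold bF; omega, by unfold bF; omega⟩

/-- `2·bF + 26 ≤ mbF` and `24·M_u + 63 ≤ mbF`. [folklore] -/
theorem mbF_floors (κ : Consts) {V : Type} [DecidableEq V] [Countable V] {G : SimpleGraph V} [G.LocallyFinite] (Φ : PlanarSkeletonFrmQuasi G) (t : V) (p : unitInterval) (D : Skelφ.StepI.DataNS V) (c : ℕ) (mk : ℕ) : 2 * bF κ Φ t p D c mk + 26 ≤ mbF κ Φ t p D c mk ∧ 24 * Mu D + 63 ≤ mbF κ Φ t p D c mk := ⟨le_max_left _ _, le_max_right _ _⟩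

/-- **(R-F2) at the y′-face bridge**: `bF ≤ nBF`, `MBF < nBF`, `MBF + bF + 2 + ρz ≤ nBF`. [folklore] -/
theorem RF2F (κ : Consts) {V : Type} [DecidableEq V] [Countable V] {G : SimpleGraph V} [G.LocallyFinite] (Φ : PlanarSkeletonFrmQuasi G) (t : V) (p : unitInterval) (D : Skelφ.StepI.DataNS V) (c : ℕ) (mk : ℕ) : bF κ Φ t p D c mk ≤ nBF κ Φ t p D c mk ∧ MBF κ Φ t p D c mk < nBF κ Φ t p D c mk ∧ MBF κ Φ t p D c mk + bF κ Φ t p D c mk + 2 + ρz D ≤ nBF κ Φ t p D c mk :=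
  ⟨(nB_facts D _ _).2.2.1, (nB_facts D _ _).2.1, (nB_facts D _ _).2.2.2⟩

/-- **The zone-index floors at the y′-face bridge**: `2·bF + 26 ≤ MBF`, `24·M_u + 63 ≤ MBF`, `M_u ≤ MBF`. [folklore] -/
theorem MBF_floors (κ : Consts) {V : Type} [DecidableEq V] [Countable V] {G : SimpleGraph V} [G.LocallyFinite] (Φ : PlanarSkeletonFrmQuasi G) (t : V) (p : unitInterval) (D : Skelφ.StepI.DataNS V) (c : ℕ) (mk : ℕ) : 2 * bF κ Φ t p D c mk + 26 ≤ MBF κ Φ t p D c mk ∧ 24 * Mu D + 63 ≤ MBF κ Φ t p D c mk ∧ Mu D ≤ MBF κ Φ t p D c mk := by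
  have h1 := (MB_facts D (mbF κ Φ t p D c mk)).2.1
  have h2 := mbF_floors κ Φ t p D c mk
  exact ⟨h2.1.trans h1, h2.2.trans h1, (MB_facts D _).1⟩

/-- **The y′-face bridge pair is admissible.** [folklore] -/
theorem bridgeF_adm (κ : Consts) {V : Type} [DecidableEq V] [Countable V] {G : SimpleGraph V} [G.LocallyFinite] (Φ : PlanarSkeletonFrmQuasi G) (t : V) (p : unitInterval) (D : Skelφ.StepI.DataNS V) (c : ℕ) (mk : ℕ) : D.M₀ ≤ (MBF κ Φ t p D c mk, nBF κ Φ t p D c mk).1 ∧ D.n₁ (MBF κ Φ t p D c mk, nBF κ Φ t p D c mk).1 ≤ (MBF κ Φ t p D c mk, nBF κ Φ t p D c mk).2 :=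
  bridge_adm D _ _

/-- **`2·bF + 27 ≤ ℓBF`** from the bridge pair's geometric clause (any map `ψ`). [folklore] -/
theorem ℓBF_ge (κ : Consts) {V : Type} [DecidableEq V] [Countable V] {G : SimpleGraph V} [G.LocallyFinite] (Φ : PlanarSkeletonFrmQuasi G) (t : V) (p : unitInterval) (D : Skelφ.StepI.DataNS V) (c : ℕ) (mk : ℕ) (ψ : V → Site 2) (hE : D.EqGeom G ψ t (MBF κ Φ t p D c mk) (nBF κ Φ t p D c mk)) : 2 * bF κ Φ t p D c mk + 27 ≤ ℓBF κ Φ t p D c mk := by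
  have h1 := ℓB_ge t D (mbF κ Φ t p D c mk) (bF κ Φ t p D c mk) ψ hE
  have h2 := (mbF_floors κ Φ t p D c mk).1
  show _ ≤ ℓB t D (mbF κ Φ t p D c mk) (bF κ Φ t p D c mk)
  omega

/-- **THE CLEARANCE THE WIDE BRIDGE BUYS**: `M_u + (c+1)·RA′ < nBF − RA′` — with `R′s ≤ RA′` the y′-run's α-recession `(k+1)·R′s` (p1-g13's recession lemma) stays
clear of the zone scale `M_u` for every region `k ≤ c − 1` from the `k = 0` origin at the top of the `hxaY` interval (`c_lo(core1) − n_L = nBF − RA′`). [folklore] -/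
theorem clearF (κ : Consts) {V : Type} [DecidableEq V] [Countable V] {G : SimpleGraph V} [G.LocallyFinite] (Φ : PlanarSkeletonFrmQuasi G) (t : V) (p : unitInterval) (D : Skelφ.StepI.DataNS V) (c : ℕ) (mk : ℕ) : ((Mu D : ℕ) : ℤ) + ((c : ℤ) + 1) * (KS0.R'0N κ Φ (KS.NQ Φ) t p D mk : ℤ) < (nBF κ Φ t p D c mk : ℤ) - KS0.R'0N κ Φ (KS.NQ Φ) t p D mk := by
  have h1 := (RF2F κ Φ t p D c mk).1
  have h2 := (bF_facts κ Φ t p D c mk).1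
  have h3 : Mu D + (c + 2) * KS0.R'0N κ Φ (KS.NQ Φ) t p D mk + 1 ≤ nBF κ Φ t p D c mk := by rw [← h2]; exact h1
  have h4 : ((Mu D + (c + 2) * KS0.R'0N κ Φ (KS.NQ Φ) t p D mk + 1 : ℕ) : ℤ) ≤ (nBF κ Φ t p D c mk : ℤ) := by exact_mod_cast h3
  push_cast at h4
  linarith

/-- **THE EXTRA-PAIR SLOT CARRYING THE y′-FACE BRIDGE** `PxF c mk := {(MBF, nBF)}` (with admissibility). [this work] -/
def PxF (c : ℕ) (mk : ℕ) : PSlot := fun κ _ _ _ _ _ Φ t p D =>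
  ⟨{(MBF κ Φ t p D c mk, nBF κ Φ t p D c mk)}, fun q hq => by rw [Finset.mem_singleton] at hq; subst hq; exact bridgeF_adm κ Φ t p D c mk⟩

-- GEN-Q (R-2, captain 2026-08-27): `PlanarSkeletonFrmFrom.NegB.KS.mem_PxF` is not in the used cone of the node top — not ported.

end BridgeF

end KS

end NegB

end PlanarSkeletonFrmQuasi

end Summit.CriticalPhenomena.PercolationContinuityZ3.Theorems.Transplant

end
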